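import Summits.BirchSwinnertonDyer.BirchSwinnertonDyer.Theorems.ByReductionTypeAtTwoMultIsogenyMuShift
import Summits.BirchSwinnertonDyer.BirchSwinnertonDyer.Theorems.ByReductionTypeAtTwoOrdKatoHalfIsogenyMu
import HarnessLib

/-!
# The integral EISENSTEIN direction of the `2`-adic main conjecture at a MULTIPLICATIVE `2` (T-mult-4-int)
# TRANSPORTS ALONG ISOGENIES at analytic rank `0`: the hedged and the member-wise WALL of item 19923 coincide
# (route ByReductionTypeAtTwo, crux `MultLowerHalfAtTwo` = stmt-BirchSwinnertonDyer-19923; seat bsd-2adic-mult-3,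
# GEN 5 — file 3 of 3)

HONEST FRAMING (cell `bsd-2adic`, HUMAN RULINGS D-0036/D-0074): THEOREMS ONLY — no definition, no named
fact, nothing asserted, closes nothing; BSD is not proved by any of this. PUBLISHED inputs displayed: the
guarded Thm-4.1 non-split analogue (`h41ns`), A236 (`h41sp`), modularity (`hmod`), GZK (`hGZK`), Greenberg's
Thm. 1.5 (`h15`), Cassels (`hCassels`); MEMO: Greenberg–Stevens at a split `2` (`hGS`, ∀-closed, used at
split members only). No Schneider / Perrin-Riou theorem is used or asserted.

WHAT. `X5.O1.MultEisensteinDivisibilityAtTwo W` (T-mult-4-int, the seat's GEN 0 typed research object and —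
isogeny-hedged — the WALL stubs of LINE `two_halves`) says: for every cyclotomic datum, newform `f`, Néron
ratio `ϖ·Ω_E = Ω⁺_f`, dual datum and generator `f_X`: `ι f_X = ι h · (ϖ·L₂(f,−1))` at a non-split `2`,
`ι(T·f_X) = ι h · (ϖ·L₂(f,1))` at a split `2`, some `h ∈ Λ`.

* §1 (pure algebra, any `p`) `exists_cofactor_of_associated`: if `f_{X'}·p^{μ}·u = f_X·p^{μ'}` in `Λ`
  (`u ∈ Λˣ`; this is `char X'·(p^μ) = char X·(p^{μ'})`, `…OrdKatoHalfIsogenyMu`), `μ + ord_p ϖ' = μ' + ord_p ϖ`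
  (the `μ`-shift law) and `M·ι f_{X'} = ι h'·(ϖ'·L)`, then `M·ι f_X = ι h·(ϖ·L)` with
  `h = h'·u·(ϖ'p^μ/(ϖ p^{μ'}))`, the last factor being a `p`-adic UNIT by the law.
* §2 **`multEisensteinDivisibilityAtTwo_of_isIsogenous`**: for ℚ-isogenous globally minimal `W ∼ W'` with
  `W` of analytic rank `0`, granted PRINT + `hGS`: T-mult-4-int at `W'` ⇒ T-mult-4-int at `W` (file 2's
  `μ`-shift law feeds §1, sign by sign; the sign, multiplicativity, analytic rank, the newform and the
  torsion of `X` all transport).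
* §3 consequences for item 19923 / LINE `two_halves` / crux 19187: on the rank-`0` multiplicative block the
  isogeny-HEDGED research object ((β), `TwoAdicMultCyc.MultEisensteinHalfAtTwoIso` resp. the line's
  `stub_eisNonsplit`/`stub_eisSplit`) IMPLIES the MEMBER-WISE one (GEN 0–4's object), hence the two are
  EQUIVALENT there (`multEisenstein_memberwise_iff_iso_rankZero`): the hedge costs nothing and gains the
  freedom to prove the divisibility at the member of one's choice.

What this is NOT: no statement at analytic rank `≥ 1` (the law is pinned by `L(E,1) ≠ 0`); no proof of any
Eisenstein divisibility; nothing booked. PARTITION (D-0054): X5@2 mult (K4ᵐ, RESIDUAL-MAP B1·O1; 1 976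
book230 classes) × p = 2 — types-the-object-of (item 19923: WALL α ⟺ β at r_an = 0); closes none.

References: R. Greenberg, LNM 1716 (1999), §1 p. 64, §4 pp. 112–113, §5 p. 121; C. Skinner, Pacific J. Math.
283 (2016) Thm. A/B (shape; p ≥ 3); J. W. S. Cassels, J. reine angew. Math. 217 (1965); L. Washington, GTM 83,
§7.1 and §13.2.
-/

set_option autoImplicit false
set_option linter.dupNamespace false

noncomputable section

open scoped Classical MatrixGroups ModularForm

open CongruenceSubgroup WeierstrassCurve Literature.NumberTheory.EllipticCurves
  Literature.NumberTheory.EllipticCurves.ModularForms Literature.NumberTheory.EllipticCurves.Greenberg1999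
  Literature.NumberTheory.EllipticCurves.Rank1Residual Literature.NumberTheory.EllipticCurves.Rank1Residual.Typed
  Summit.BirchSwinnertonDyer.Rank1Residual Summit.BirchSwinnertonDyer.Rank1Residual.X5
  Summit.BirchSwinnertonDyer.BirchSwinnertonDyer.Theorems.IsogenyMuShift

universe u

namespace Summit.BirchSwinnertonDyer.BirchSwinnertonDyer.Theorems.MultIsogenyShift

/-! ## §1 Pure algebra: moving an Eisenstein cofactor across associated generators -/

section Algebra

variable {p : ℕ} [Fact p.Prime]

/-- **Moving an Eisenstein cofactor across an isogeny (pure `Λ`-algebra).** In `Λ = ℤ_p⟦T⟧` let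
`f_{X'}·p^{μ}·u = f_X·p^{μ'}` with `u` a unit, let `ϖ, ϖ' ∈ ℚˣ` satisfy the `μ`-shift law
`μ + ord_p ϖ' = μ' + ord_p ϖ`, and let `M ∈ ℚ_p⟦T⟧`. If `M·ι f_{X'} = ι h'·(ϖ'·L)` for some `h' ∈ Λ`, then
`M·ι f_X = ι h·(ϖ·L)` for some `h ∈ Λ`: `h = h'·u·c` with `c = ϖ'·p^{μ}/(ϖ·p^{μ'})`, a `p`-adic unit by the
law (so `c ∈ ℤ_p`). [cite: Washington1997, §7.1 (Weierstrass preparation; units of Λ)] -/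
theorem exists_cofactor_of_associated {fX fX' h' : IwasawaAlgebra p} {u : (IwasawaAlgebra p)ˣ}
    {μ μ' : ℕ} {ϖ ϖ' : ℚ} (hϖ0 : ϖ ≠ 0) (hϖ'0 : ϖ' ≠ 0)
    (hu : fX' * PowerSeries.C ((p : ℤ_[p]) ^ μ) * u = fX * PowerSeries.C ((p : ℤ_[p]) ^ μ'))
    (hlaw : (μ : ℤ) + padicValRat p ϖ' = (μ' : ℤ) + padicValRat p ϖ)
    {M L : PowerSeries ℚ_[p]}
    (hE' : M * iwasawaToPowerSeries p fX' =
      iwasawaToPowerSeries p h' * (PowerSeries.C (ϖ' : ℚ_[p]) * L)) :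
    ∃ h : IwasawaAlgebra p, M * iwasawaToPowerSeries p fX =
      iwasawaToPowerSeries p h * (PowerSeries.C (ϖ : ℚ_[p]) * L) := by
  have hp : (p : ℚ) ≠ 0 := by exact_mod_cast (Fact.out : p.Prime).ne_zero
  have hp1 : 1 < p := (Fact.out : p.Prime).one_lt
  -- the rational `c = ϖ'·p^μ / (ϖ·p^μ')` is a `p`-adic unit by the law
  set c : ℚ := ϖ' * (p : ℚ) ^ μ / (ϖ * (p : ℚ) ^ μ') with hc_def
  have hnum : ϖ' * (p : ℚ) ^ μ ≠ 0 := mul_ne_zero hϖ'0 (pow_ne_zero _ hp)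
  have hden : ϖ * (p : ℚ) ^ μ' ≠ 0 := mul_ne_zero hϖ0 (pow_ne_zero _ hp)
  have hc0 : c ≠ 0 := div_ne_zero hnum hden
  have hcval : padicValRat p c = 0 := by
    rw [hc_def, padicValRat.div hnum hden, padicValRat.mul hϖ'0 (pow_ne_zero _ hp),
      padicValRat.mul hϖ0 (pow_ne_zero _ hp), padicValRat.pow (p : ℚ), padicValRat.pow (p : ℚ),
      padicValRat.self hp1]
    linarith
  have hcnorm : ‖((c : ℚ) : ℚ_[p])‖ ≤ 1 := by
    rw [Padic.norm_le_one_iff_val_nonneg, Padic.valuation_ratCast, hcval]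
  set c₀ : ℤ_[p] := ⟨((c : ℚ) : ℚ_[p]), hcnorm⟩ with hc₀_def
  have hc₀ : ((c₀ : ℤ_[p]) : ℚ_[p]) = ((c : ℚ) : ℚ_[p]) := rfl
  -- scalar identity `c·ϖ·p^μ' = ϖ'·p^μ` in `ℚ_p`
  have hscal : ((c : ℚ) : ℚ_[p]) * (ϖ : ℚ_[p]) * (p : ℚ_[p]) ^ μ' = (ϖ' : ℚ_[p]) * (p : ℚ_[p]) ^ μ := by
    have h1 : c * (ϖ * (p : ℚ) ^ μ') = ϖ' * (p : ℚ) ^ μ := div_mul_cancel₀ _ hden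
    have h2 : ((c * (ϖ * (p : ℚ) ^ μ') : ℚ) : ℚ_[p]) = ((ϖ' * (p : ℚ) ^ μ : ℚ) : ℚ_[p]) := by rw [h1]
    push_cast at h2
    linear_combination h2
  -- the images under `ι`
  have hιu : iwasawaToPowerSeries p (fX * PowerSeries.C ((p : ℤ_[p]) ^ μ')) =
      iwasawaToPowerSeries p fX' * PowerSeries.C ((p : ℚ_[p]) ^ μ) * iwasawaToPowerSeries p (u : IwasawaAlgebra p) := by
    rw [← hu, map_mul, map_mul, iwasawaToPowerSeries_C]
    push_cast
    ring
  have hιl : iwasawaToPowerSeries p (fX * PowerSeries.C ((p : ℤ_[p]) ^ μ')) =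
      iwasawaToPowerSeries p fX * PowerSeries.C ((p : ℚ_[p]) ^ μ') := by
    rw [map_mul, iwasawaToPowerSeries_C]
    push_cast
    ring
  have hCp : PowerSeries.C ((p : ℚ_[p]) ^ μ') ≠ 0 := by
    rw [Ne, ← map_zero (PowerSeries.C (R := ℚ_[p])), (PowerSeries.C_injective).eq_iff]
    exact pow_ne_zero _ (by exact_mod_cast (Fact.out : p.Prime).ne_zero)
  refine ⟨h' * (u : IwasawaAlgebra p) * PowerSeries.C c₀, ?_⟩
  apply mul_right_cancel₀ hCp
  have hC3 : PowerSeries.C ((c : ℚ) : ℚ_[p]) * PowerSeries.C (ϖ : ℚ_[p]) * PowerSeries.C ((p : ℚ_[p]) ^ μ') =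
      PowerSeries.C (ϖ' : ℚ_[p]) * PowerSeries.C ((p : ℚ_[p]) ^ μ) := by
    rw [← map_mul, ← map_mul, ← map_mul, hscal]
  calc M * iwasawaToPowerSeries p fX * PowerSeries.C ((p : ℚ_[p]) ^ μ')
      = M * (iwasawaToPowerSeries p fX' * PowerSeries.C ((p : ℚ_[p]) ^ μ) *
          iwasawaToPowerSeries p (u : IwasawaAlgebra p)) := by rw [mul_assoc, ← hιl, hιu]
    _ = (M * iwasawaToPowerSeries p fX') * PowerSeries.C ((p : ℚ_[p]) ^ μ) *
          iwasawaToPowerSeries p (u : IwasawaAlgebra p) := by ring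
    _ = iwasawaToPowerSeries p h' * (PowerSeries.C (ϖ' : ℚ_[p]) * L) * PowerSeries.C ((p : ℚ_[p]) ^ μ) *
          iwasawaToPowerSeries p (u : IwasawaAlgebra p) := by rw [hE']
    _ = iwasawaToPowerSeries p h' * iwasawaToPowerSeries p (u : IwasawaAlgebra p) * L *
          (PowerSeries.C (ϖ' : ℚ_[p]) * PowerSeries.C ((p : ℚ_[p]) ^ μ)) := by ring
    _ = iwasawaToPowerSeries p h' * iwasawaToPowerSeries p (u : IwasawaAlgebra p) * L *
          (PowerSeries.C ((c : ℚ) : ℚ_[p]) * PowerSeries.C (ϖ : ℚ_[p]) * PowerSeries.C ((p : ℚ_[p]) ^ μ')) := by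
        rw [hC3]
    _ = iwasawaToPowerSeries p (h' * (u : IwasawaAlgebra p) * PowerSeries.C c₀) *
          (PowerSeries.C (ϖ : ℚ_[p]) * L) * PowerSeries.C ((p : ℚ_[p]) ^ μ') := by
        rw [map_mul, map_mul, iwasawaToPowerSeries_C, hc₀]
        ring

end Algebra

/-! ## §2 T-mult-4-int transports along isogenies at analytic rank `0` -/

section Transport

variable {W W' : WeierstrassCurve ℚ} [W.IsElliptic] [W'.IsElliptic] [W.IsGloballyMinimal]
  [W'.IsGloballyMinimal]

/-- **T-mult-4-int TRANSPORTS ALONG ISOGENIES (analytic rank `0`).** `W ∼ W'` ℚ-isogenous globally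
minimal curves, `W` of analytic rank `0`; PUB: guarded Thm-4.1 non-split analogue (`h41ns`), A236
(`h41sp`), modularity, GZK, Greenberg's Thm. 1.5 (`X` torsion at a multiplicative prime), Cassels; MEMO:
Greenberg–Stevens at a split `2` (`hGS`). IF `X5.O1.MultEisensteinDivisibilityAtTwo W'` THEN
`X5.O1.MultEisensteinDivisibilityAtTwo W`. Proof: at a datum `(κ, γ, f, ϖ, D, f_X)` of `W` and a sign,
choose a dual datum `D'` of `W'`, the same newform (`IsNewformOf.of_isIsogenous`), a Néron ratio `ϖ'` at
`W'` (`exists_varpi_of_isogeny`) and a generator `f_{X'}`; the generators are associated up to the powers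
`2^{μ}`, `2^{μ'}` (`SelmerDualData.isTorsion_and_charIdeal_mul_span_eq_of_isIsogenous`), the `μ`-SHIFT LAW
(file 2) balances the exponents against `ord₂ ϖ' − ord₂ ϖ`, and §1 moves the cofactor.
[cite: GreenbergLNM1716, §1 p. 64, §4 pp. 112–113 and §5 p. 121] [cite: Skinner2016PacificMC, Thm. A and Thm. B (shape; p ≥ 3)]
[cite: MilneADT2006, Thm. I.7.3 (Cassels)] -/
theorem multEisensteinDivisibilityAtTwo_of_isIsogenous
    (h41ns : thm41Analogue_charValue_rankZero_numberField_anyPrime_oddLocalDegree)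
    (h41sp : thm41Analogue_charValue_rankZero_split_baseChange_anyPrime)
    (hmod : nonempty_modularParametrizationData)
    (hGZK : rank_eq_analyticRank_of_analyticRank_le_one)
    (h15 : thm15_isTorsion_multiplicative_rat)
    (hCassels : bsdRHS_eq_of_isIsogenous)
    (hGS : ∀ (V : WeierstrassCurve ℚ) [V.IsElliptic] [V.IsGloballyMinimal],
      V.HasSplitMultiplicativeReductionAtPrime 2 → greenberg_stevens (W := V) (p := 2))
    (hiso : IsIsogenous W W') (hr : W.analyticRank = 0)
    (hE' : O1.MultEisensteinDivisibilityAtTwo W') : O1.MultEisensteinDivisibilityAtTwo W := by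
  intro κ γ hκ hγ hγ' hmult N _ f hf ϖ hϖ D fX hchar
  haveI : Module.Finite (IwasawaAlgebra 2) D.X := D.module_finite_holds hγ
  have hL : W.entireLFunction 1 ≠ 0 := entireLFunction_one_ne_zero_of_analyticRank_eq_zero hmod W hr
  have hX : D.IsTorsion := h15 W 2 hmult f hf κ γ hκ hγ D
  have hmult' : Mult W' 2 := mult_two_of_isIsogenous hiso hmult
  have hϖ0 : ϖ ≠ 0 := X2.varpi_ne_zero_of_isNewformOf hf hϖ
  -- data at `W'`
  have hiso' := hiso
  obtain ⟨φ⟩ := hiso'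
  obtain ⟨D'⟩ := W'.nonempty_selmerDualData_holds κ γ hγ
  haveI : Module.Finite (IwasawaAlgebra 2) D'.X := D'.module_finite_holds hγ
  have hf' : IsNewformOf W' f := hf.of_isIsogenous hiso.symm_of_charZero
  obtain ⟨ϖ', hϖ'⟩ := exists_varpi_of_isogeny hmod φ hϖ
  have hϖ'0 : ϖ' ≠ 0 := X2.varpi_ne_zero_of_isNewformOf hf' hϖ'
  obtain ⟨fX', hfX'⟩ := (charIdeal_isPrincipal_holds 2 D'.X).principal
  have hchar' : D'.charIdeal = Ideal.span {fX'} := hfX'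
  -- the clause package at `W'`
  have hcl' := hE' κ γ hκ hγ hγ' hmult' f hf' ϖ' hϖ' D' fX' hchar'
  -- associated generators up to the powers `2^μ`, `2^μ'`
  obtain ⟨-, key⟩ := D.isTorsion_and_charIdeal_mul_span_eq_of_isIsogenous D' hiso hγ hX
  rw [hchar, hchar', Ideal.span_singleton_mul_span_singleton, Ideal.span_singleton_mul_span_singleton,
    Ideal.span_singleton_eq_span_singleton] at key
  obtain ⟨u, hu⟩ := key
  -- the `μ`-shift law at analytic rank `0`
  have hlaw := mu_add_padicValRat_eq_of_isIsogenous h41ns h41sp hGZK hCassels hGS hiso hmult hL hκ hγ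
    hγ' hf D D' hX hϖ hϖ'
  refine ⟨fun hns L hLf => ?_, fun hsp L hLf => ?_⟩
  · -- non-split at `W`, hence at `W'`
    have hns' : ¬ W'.HasSplitMultiplicativeReductionAtPrime 2 :=
      fun h => hns ((hasSplitMultiplicativeReductionAtPrime_two_iff_of_isIsogenous hiso).mpr h)
    obtain ⟨h', hE'cl⟩ := hcl'.1 hns' L hLf
    obtain ⟨h, hh⟩ := exists_cofactor_of_associated (M := 1) hϖ0 hϖ'0 hu hlaw
      (by rw [one_mul]; exact hE'cl)
    exact ⟨h, by rw [one_mul] at hh; exact hh⟩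
  · -- split at `W`, hence at `W'`
    have hsp' : W'.HasSplitMultiplicativeReductionAtPrime 2 :=
      (hasSplitMultiplicativeReductionAtPrime_two_iff_of_isIsogenous hiso).mp hsp
    obtain ⟨h', hE'cl⟩ := hcl'.2 hsp' L hLf
    rw [map_mul] at hE'cl
    obtain ⟨h, hh⟩ := exists_cofactor_of_associated (M := iwasawaToPowerSeries 2 PowerSeries.X)
      hϖ0 hϖ'0 hu hlaw hE'cl
    exact ⟨h, by rw [map_mul]; exact hh⟩

/-- **∀-closed on the rank-`0` multiplicative block: T-mult-4-int is an ISOGENY-CLASS INVARIANT there.**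
Granted PRINT + `hGS`, for ℚ-isogenous globally minimal `W ∼ W'` with `W` multiplicative at `2` of analytic
rank `0`: `MultEisensteinDivisibilityAtTwo W' ↔ MultEisensteinDivisibilityAtTwo W`.
[cite: GreenbergLNM1716, §1 p. 64 and §5 p. 121] [cite: MilneADT2006, Thm. I.7.3 (Cassels)] -/
theorem multEisensteinDivisibilityAtTwo_iff_of_isIsogenous
    (h41ns : thm41Analogue_charValue_rankZero_numberField_anyPrime_oddLocalDegree)
    (h41sp : thm41Analogue_charValue_rankZero_split_baseChange_anyPrime)
    (hmod : nonempty_modularParametrizationData)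
    (hGZK : rank_eq_analyticRank_of_analyticRank_le_one)
    (h15 : thm15_isTorsion_multiplicative_rat)
    (hCassels : bsdRHS_eq_of_isIsogenous)
    (hGS : ∀ (V : WeierstrassCurve ℚ) [V.IsElliptic] [V.IsGloballyMinimal],
      V.HasSplitMultiplicativeReductionAtPrime 2 → greenberg_stevens (W := V) (p := 2))
    (hiso : IsIsogenous W W') (hr : W.analyticRank = 0) :
    O1.MultEisensteinDivisibilityAtTwo W' ↔ O1.MultEisensteinDivisibilityAtTwo W :=
  ⟨multEisensteinDivisibilityAtTwo_of_isIsogenous h41ns h41sp hmod hGZK h15 hCassels hGS hiso hr,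
    multEisensteinDivisibilityAtTwo_of_isIsogenous h41ns h41sp hmod hGZK h15 hCassels hGS
      hiso.symm_of_charZero (analyticRank_eq_zero_of_isIsogenous hiso hr)⟩

end Transport

/-! ## §3 Consequences for item 19923, LINE `two_halves`, crux 19187: hedged = member-wise at rank `0` -/

section Walls

/-- **The HEDGED sign-split WALL stubs of LINE `two_halves` give the MEMBER-WISE object at analytic rank
`0`.** Granted PRINT ×6 + MEMO `hGS`: if every non-CM rank-`0` curve with non-split (`hEns`) resp. split
(`hEsp`) multiplicative reduction at `2` has SOME isogenous globally minimal member carrying T-mult-4-int, then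
EVERY such curve carries it (GEN 0–4's member-wise object, the hypothesis of
`multLowerHalfAtTwo_of_multEisenstein_of_cotorsion`). [cite: GreenbergLNM1716, §1 p. 64 and §5 p. 121]
[cite: Skinner2016PacificMC, Thm. A and Thm. B (shape; p ≥ 3)] -/
theorem multEisenstein_memberwise_of_iso_bySign
    (h41ns : thm41Analogue_charValue_rankZero_numberField_anyPrime_oddLocalDegree)
    (h41sp : thm41Analogue_charValue_rankZero_split_baseChange_anyPrime)
    (hmod : nonempty_modularParametrizationData)
    (hGZK : rank_eq_analyticRank_of_analyticRank_le_one)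
    (h15 : thm15_isTorsion_multiplicative_rat)
    (hCassels : bsdRHS_eq_of_isIsogenous)
    (hGS : ∀ (V : WeierstrassCurve ℚ) [V.IsElliptic] [V.IsGloballyMinimal],
      V.HasSplitMultiplicativeReductionAtPrime 2 → greenberg_stevens (W := V) (p := 2))
    (hEns : ∀ (W : WeierstrassCurve ℚ) [W.IsElliptic] [W.IsGloballyMinimal], ¬ W.HasCM →
      W.analyticRank = 0 → Mult W 2 → ¬ W.HasSplitMultiplicativeReductionAtPrime 2 →
        ∃ (W' : WeierstrassCurve ℚ) (_ : W'.IsElliptic) (_ : W'.IsGloballyMinimal),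
          IsIsogenous W W' ∧ Mult W' 2 ∧ O1.MultEisensteinDivisibilityAtTwo W')
    (hEsp : ∀ (W : WeierstrassCurve ℚ) [W.IsElliptic] [W.IsGloballyMinimal], ¬ W.HasCM →
      W.analyticRank = 0 → Mult W 2 → W.HasSplitMultiplicativeReductionAtPrime 2 →
        ∃ (W' : WeierstrassCurve ℚ) (_ : W'.IsElliptic) (_ : W'.IsGloballyMinimal),
          IsIsogenous W W' ∧ Mult W' 2 ∧ O1.MultEisensteinDivisibilityAtTwo W') :
    ∀ (W : WeierstrassCurve ℚ) [W.IsElliptic] [W.IsGloballyMinimal], ¬ W.HasCM →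
      W.analyticRank = 0 → Mult W 2 → O1.MultEisensteinDivisibilityAtTwo W := by
  intro W _ _ hcm hr hmult
  obtain ⟨W', _, _, hiso, -, hE'⟩ :
      ∃ (W' : WeierstrassCurve ℚ) (_ : W'.IsElliptic) (_ : W'.IsGloballyMinimal),
        IsIsogenous W W' ∧ Mult W' 2 ∧ O1.MultEisensteinDivisibilityAtTwo W' := by
    by_cases hs : W.HasSplitMultiplicativeReductionAtPrime 2
    · exact hEsp W hcm hr hmult hs
    · exact hEns W hcm hr hmult hs
  exact multEisensteinDivisibilityAtTwo_of_isIsogenous h41ns h41sp hmod hGZK h15 hCassels hGS hiso hr hE'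

/-- **α ⟺ β at analytic rank `0` (item 19923's WALL).** Granted PRINT ×6 + MEMO `hGS`, the member-wise
∀-object of GEN 0–4 («T-mult-4-int at every non-CM rank-`0` curve multiplicative at `2`») and the
isogeny-hedged one («… at SOME isogenous globally minimal multiplicative-at-`2` member») are EQUIVALENT. So the
(β)-hedge on LINE `two_halves` (and on crux 19187's `stub_multEisensteinIso`, restricted to rank `0`) loses
nothing and costs nothing. [cite: GreenbergLNM1716, §1 p. 64 and §5 p. 121] [cite: MilneADT2006, Thm. I.7.3 (Cassels)] -/
theorem multEisenstein_memberwise_iff_iso_rankZero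
    (h41ns : thm41Analogue_charValue_rankZero_numberField_anyPrime_oddLocalDegree)
    (h41sp : thm41Analogue_charValue_rankZero_split_baseChange_anyPrime)
    (hmod : nonempty_modularParametrizationData)
    (hGZK : rank_eq_analyticRank_of_analyticRank_le_one)
    (h15 : thm15_isTorsion_multiplicative_rat)
    (hCassels : bsdRHS_eq_of_isIsogenous)
    (hGS : ∀ (V : WeierstrassCurve ℚ) [V.IsElliptic] [V.IsGloballyMinimal],
      V.HasSplitMultiplicativeReductionAtPrime 2 → greenberg_stevens (W := V) (p := 2)) :
    (∀ (W : WeierstrassCurve ℚ) [W.IsElliptic] [W.IsGloballyMinimal], ¬ W.HasCM →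
      W.analyticRank = 0 → Mult W 2 → O1.MultEisensteinDivisibilityAtTwo W) ↔
    (∀ (W : WeierstrassCurve ℚ) [W.IsElliptic] [W.IsGloballyMinimal], ¬ W.HasCM →
      W.analyticRank = 0 → Mult W 2 →
        ∃ (W' : WeierstrassCurve ℚ) (_ : W'.IsElliptic) (_ : W'.IsGloballyMinimal),
          IsIsogenous W W' ∧ Mult W' 2 ∧ O1.MultEisensteinDivisibilityAtTwo W') := by
  constructor
  · intro h W _ _ hcm hr hmult
    exact ⟨W, inferInstance, inferInstance, isIsogenous_self W, hmult, h W hcm hr hmult⟩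
  · intro h W _ _ hcm hr hmult
    obtain ⟨W', _, _, hiso, -, hE'⟩ := h W hcm hr hmult
    exact multEisensteinDivisibilityAtTwo_of_isIsogenous h41ns h41sp hmod hGZK h15 hCassels hGS hiso hr hE'

/-- **S3ᵐ's hedged leaf gives K4ᵐ's member-wise object at rank `0`, BY NAME.** Granted PRINT + MEMO,
conv-2's carrier constant `TwoAdicMultCyc.MultEisensteinHalfAtTwoIso` (= LINE cycint's `stub_multEisensteinIso` on
crux 19187) implies T-mult-4-int at EVERY non-CM rank-`0` curve multiplicative at `2` — the hypothesis `hE` of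
`multLowerHalfAtTwo_of_multEisenstein_of_cotorsion` (p432673) and of conv-2's `multLowerHalfAtTwo_of_cycChildren`.
[cite: GreenbergLNM1716, §1 p. 64 and §5 p. 121] [cite: Skinner2016PacificMC, Thm. A and Thm. B (shape; p ≥ 3)] -/
theorem multEisenstein_memberwise_rankZero_of_multEisensteinHalfAtTwoIso
    (h41ns : thm41Analogue_charValue_rankZero_numberField_anyPrime_oddLocalDegree)
    (h41sp : thm41Analogue_charValue_rankZero_split_baseChange_anyPrime)
    (hmod : nonempty_modularParametrizationData)
    (hGZK : rank_eq_analyticRank_of_analyticRank_le_one)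
    (h15 : thm15_isTorsion_multiplicative_rat)
    (hCassels : bsdRHS_eq_of_isIsogenous)
    (hGS : ∀ (V : WeierstrassCurve ℚ) [V.IsElliptic] [V.IsGloballyMinimal],
      V.HasSplitMultiplicativeReductionAtPrime 2 → greenberg_stevens (W := V) (p := 2))
    (hE : TwoAdicMultCyc.MultEisensteinHalfAtTwoIso) :
    ∀ (W : WeierstrassCurve ℚ) [W.IsElliptic] [W.IsGloballyMinimal], ¬ W.HasCM →
      W.analyticRank = 0 → Mult W 2 → O1.MultEisensteinDivisibilityAtTwo W := by
  intro W _ _ hcm hr hmult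
  obtain ⟨W', _, _, hiso, -, hE'⟩ := hE W hcm hmult
  exact multEisensteinDivisibilityAtTwo_of_isIsogenous h41ns h41sp hmod hGZK h15 hCassels hGS hiso hr hE'

end Walls

end Summit.BirchSwinnertonDyer.BirchSwinnertonDyer.Theorems.MultIsogenyShift

end
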